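import Summits.QuantumFields.YangMills.Theorems.BalabanUVNodesN19TiltPathCalculus
import Literature.Probability.Process.CondExpBayes

/-!
# BalabanUVNodes ∕ node N14 = NE1′ — LENS control CARD 11, THE N14-LANE REMAINDER (II): ON THE STRAIGHT CHORD — the conditioned defect is MONOTONE (R2),
# and the N1 TOY (matched endpoints, non-vanishing first-order Feynman–Hellmann term)

Cell `pub-ymgap`, HUMAN RULING D-0062 (Track A at full width), seat `pub-ymgap-dag-n14-c` (R134 ACCELERATION, strategy s1), generation 7 (idle re-seat);
route `Summits/QuantumFields/YangMills/Theses/BalabanUVNodes.lean` rev 18∕19 (cluster K3⁗ `SpineGivenEndpointR13Sep` = stmt-QuantumFields-20292,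
`--kind proof --supports … --as helper`); venue ruling R424 (`YangMills/Theorems`, namespace `YMDAG.N14.LawChannelStraightChord`).  ADDITIVE — imports dag-n19-c's
module I `…N19TiltPathCalculus` (for `integrable_of_abs_le` and this lineage's file P `…N14LawChannel`: `tiltedMean`, `cov[·,·;·]`) and the tree's
`Literature/Probability/Process/CondExpBayes` (abstract Bayes formula for tilted measures, Kallianpur–Striebel form); THEOREMS ONLY (0 `def`), modifies nothing.
Companion of `…N14LawChannelTuned` (K11b ∕ R1 ∕ R1′, same day; split by the 400-line rule).

SOURCE OF RECORD.  LENS control v6.0 §B (B1), (B4) (planner seat `ym-lens-BalabanUVNodes-control` g7, memo `LENS-control.md` v6.0 b6dee8b86c4ff517, farm-checked sketch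
`Sketch-control-g7.lean` d9b91efbe9c6728d §4 R2 and §5 — SIGNATURES LIFTED VERBATIM WITH CREDIT; row s17 «free to lift with credit, idle-seat only»).  Bodies are this seat's.

WHAT THIS IS.
* §1 [folklore; absent from the tree in `condExp` form] `exp_mul_mem_Icc`, `condExp_tilted_ae_eq_div` (Bayes for the straight tilt read `μ`-a.e., with the conditional
  normaliser bounded below by `e^{−|v|·C_D}`), and ★ **R2 `condExp_tilted_mono`** — for bounded measurable `D` and `u ≤ u′`,
  `(μ.tilted (u·D))[D | m] ≤ (μ.tilted (u′·D))[D | m]` `μ`-a.e.: the conditioned one-step defect is NON-DECREASING along the STRAIGHT interpolation (conditional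
  Chebyshev ∕ association, KERNEL-FREE: the pointwise inequality `(D − c)(e^{(u′−u)D} − e^{(u′−u)c})·e^{uD} ≥ 0` with the `m`-measurable ratio `c = (μ.tilted (u·D))[D | m]`
  is pulled through `μ[· | m]` — `condExp_mono` + the pull-out property for the `m`-measurable factors — the `u`-terms cancel by Bayes at `u`, and Bayes at `u′` divides by the
  positive normaliser).  Census V61–V62 of the memo: TRUE, and USELESS AT THE RECORD — the window bound it yields (`osc(h_u) ≤ osc(h_0) + 2∫(h_1 − h_0)`) pays the mean
  FIBRE VARIANCE of the extensive defect.
* §2 [folklore; explicit four-point computation] `integral_uniform_bool_sq`, `isProbabilityMeasure_uniform_bool_sq`, and ★ **N1 TOY `toy_matchedEndpoints_cov_ne_zero`** —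
  on `Bool × Bool` with the uniform law, unit field `x = p.1`, fluctuation `z = p.2`, fibre-blind observable `F = ±1`, defect `D = a·F + c·𝟙{x ∧ z}` with
  `a = −½·log((1 + e^c)∕2)` chosen so that the ENDPOINTS MATCH (`tiltedMean F (μ.tilted D) 0 = tiltedMean F μ 0`): yet the first-order Feynman–Hellmann term along
  the straight chord does not vanish, `Cov_μ(F, D) = −½·log cosh(c∕2)` (`≠ 0` for `c ≠ 0`) — matching the increment never matches the slope (strict convexity of the fibre
  log-MGF); the Λ-mismatch of memo §B (B1) (obstruction N1 to the straight-path law channel) in miniature.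

WHAT THIS IS NOT.  Everything here is PROVED (0 `sorry`, 0 named facts).  A decided toy and a true-but-idle monotonicity; nothing of Bałaban's is instantiated;
N14 ∕ N19 NOT discharged; count-neutral.  One finite four-torus programme at fixed ε; NOT ℝ⁴, NOT OS, NOT a mass gap, NOT Clay.
-/

set_option autoImplicit false

noncomputable section

namespace YMDAG.N14.LawChannelStraightChord

open MeasureTheory ProbabilityTheory Set Filter Topology
open scoped ENNReal
open Summit.QuantumFields.BalabanUV.T4Continuum.NE1p.DressedMGFForm (tiltedMean)
open Summit.QuantumFields.YangMills.BalabanUVNodes.N19TiltPathCalculus (integrable_of_abs_le)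

/-! ## §1 R2 — the conditioned defect is non-decreasing along the straight path (conditional Chebyshev, kernel-free) -/
section Monotone

variable {Ω : Type*} {m m₀ : MeasurableSpace Ω} {μ : Measure Ω} [IsFiniteMeasure μ] [NeZero μ] {D : Ω → ℝ} {CD : ℝ}

/-- The straight tilt weight `e^{v·D}` is bounded between `e^{−|v|·C_D}` and `e^{|v|·C_D}`. [folklore] -/
theorem exp_mul_mem_Icc (hDb : ∀ x, |D x| ≤ CD) (v : ℝ) (x : Ω) :
    Real.exp (-(|v| * CD)) ≤ Real.exp (v * D x) ∧ Real.exp (v * D x) ≤ Real.exp (|v| * CD) := by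
  have h : |v * D x| ≤ |v| * CD := by rw [abs_mul]; exact mul_le_mul_of_nonneg_left (hDb x) (abs_nonneg v)
  exact ⟨Real.exp_le_exp.2 (neg_le.1 ((neg_le_abs _).trans h)), Real.exp_le_exp.2 ((le_abs_self _).trans h)⟩

/-- **BAYES FOR THE STRAIGHT TILT, READ `μ`-a.e.** [folklore ∘ tree `CondExpBayes.condExp_tilted_ae_eq_smul`]: for bounded measurable `D`,
`(μ.tilted (v·D))[D | m] = μ[e^{vD}·D | m] ∕ μ[e^{vD} | m]` holds `μ`-almost everywhere (the tilt and `μ` are equivalent), and the conditional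
normaliser is bounded below, `μ[e^{vD} | m] ≥ e^{−|v|·C_D}` `μ`-a.e. -/
theorem condExp_tilted_ae_eq_div (hm : m ≤ m₀) (hDm : Measurable D) (hDb : ∀ x, |D x| ≤ CD) (v : ℝ) :
    (∀ᵐ x ∂μ, ((μ.tilted fun x => v * D x)[D|m]) x =
        ((μ[fun x => Real.exp (v * D x)|m]) x)⁻¹ * (μ[fun x => Real.exp (v * D x) • D x|m]) x) ∧
      ∀ᵐ x ∂μ, Real.exp (-(|v| * CD)) ≤ (μ[fun x => Real.exp (v * D x)|m]) x := by
  have hgm : Measurable fun x => v * D x := measurable_const.mul hDm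
  have hgi : Integrable (fun x => Real.exp (v * D x)) μ :=
    integrable_of_abs_le (Real.measurable_exp.comp hgm) fun x => by
      rw [Real.abs_exp]; exact (exp_mul_mem_Icc hDb v x).2
  haveI : IsProbabilityMeasure (μ.tilted fun x => v * D x) := isProbabilityMeasure_tilted hgi
  have hDi : Integrable D (μ.tilted fun x => v * D x) := integrable_of_abs_le hDm hDb
  have hbayes := Literature.Probability.Process.condExp_tilted_ae_eq_smul (E := ℝ) hm hgm hgi hDi
  have hac : μ ≪ μ.tilted fun x => v * D x := absolutelyContinuous_tilted hgi
  refine ⟨?_, ?_⟩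
  · filter_upwards [hac.ae_le hbayes] with x hx
    rw [hx, smul_eq_mul]
  · have hmono := condExp_mono (m := m) (integrable_const (Real.exp (-(|v| * CD)))) hgi
      (Eventually.of_forall fun x => (exp_mul_mem_Icc hDb v x).1)
    filter_upwards [hmono] with x hx
    rwa [condExp_const hm] at hx

/-- **R2 — MONOTONE CONDITIONED TILT** (LENS control sketch §4, credited; absent from the tree in `condExp` form): for a finite nonzero `μ`, a sub-σ-algebra
`m ≤ m₀`, a bounded measurable `D` and `u ≤ u′`, `(μ.tilted (u·D))[D | m] ≤ (μ.tilted (u′·D))[D | m]` `μ`-a.e. — the conditioned defect is non-decreasing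
along the STRAIGHT path.  KERNEL-FREE PROOF: with the `m`-measurable ratio `c := (μ.tilted (u·D))[D | m]` (`= μ[D e^{uD} | m] ∕ μ[e^{uD} | m]` a.e.), the
pointwise inequality `(D − c)(e^{(u′−u)D} − e^{(u′−u)c})·e^{uD} ≥ 0` (two factors of the same sign) is pulled through `μ[· | m]` (`condExp_mono`, pull-out of
the `m`-measurable factors `c`, `e^{(u′−u)c}`), the `u`-terms cancel by Bayes at `u`, and Bayes at `u′` divides by `μ[e^{u′D} | m] > 0`.  Census V61–V62 of
the memo: TRUE, and useless at the record — the window bound it yields pays the mean FIBRE VARIANCE of the extensive defect. [folklore] -/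
theorem condExp_tilted_mono (hm : m ≤ m₀) (hDm : Measurable D) (hDb : ∀ x, |D x| ≤ CD) {u u' : ℝ} (huu' : u ≤ u') :
    (μ.tilted fun x => u * D x)[D|m] ≤ᵐ[μ] (μ.tilted fun x => u' * D x)[D|m] := by
  -- letters
  set e₁ : Ω → ℝ := fun x => Real.exp (u * D x) with he₁
  set e₂ : Ω → ℝ := fun x => Real.exp (u' * D x) with he₂
  set b₁ : Ω → ℝ := fun x => Real.exp (u * D x) • D x with hb₁
  set b₂ : Ω → ℝ := fun x => Real.exp (u' * D x) • D x with hb₂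
  set c : Ω → ℝ := (μ.tilted fun x => u * D x)[D|m] with hc
  set E : Ω → ℝ := fun x => Real.exp ((u' - u) * c x) with hE
  -- Bayes at `u` and at `u'`, positivity of the conditional normalisers
  obtain ⟨hB₁, hA₁⟩ := condExp_tilted_ae_eq_div (μ := μ) hm hDm hDb u
  obtain ⟨hB₂, hA₂⟩ := condExp_tilted_ae_eq_div (μ := μ) hm hDm hDb u'
  -- measurability ∕ integrability of the letters
  have he₁m : Measurable e₁ := Real.measurable_exp.comp (measurable_const.mul hDm)
  have he₂m : Measurable e₂ := Real.measurable_exp.comp (measurable_const.mul hDm)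
  have he₁b : ∀ x, |e₁ x| ≤ Real.exp (|u| * CD) := fun x => by
    rw [he₁, Real.abs_exp]; exact (exp_mul_mem_Icc hDb u x).2
  have he₂b : ∀ x, |e₂ x| ≤ Real.exp (|u'| * CD) := fun x => by
    rw [he₂, Real.abs_exp]; exact (exp_mul_mem_Icc hDb u' x).2
  have hb₁m : Measurable b₁ := he₁m.smul hDm
  have hb₂m : Measurable b₂ := he₂m.smul hDm
  have hb₁b : ∀ x, |b₁ x| ≤ Real.exp (|u| * CD) * CD := fun x => by
    rw [hb₁]; dsimp only; rw [smul_eq_mul, abs_mul, Real.abs_exp]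
    exact mul_le_mul (exp_mul_mem_Icc hDb u x).2 (hDb x) (abs_nonneg _) (Real.exp_pos _).le
  have hb₂b : ∀ x, |b₂ x| ≤ Real.exp (|u'| * CD) * CD := fun x => by
    rw [hb₂]; dsimp only; rw [smul_eq_mul, abs_mul, Real.abs_exp]
    exact mul_le_mul (exp_mul_mem_Icc hDb u' x).2 (hDb x) (abs_nonneg _) (Real.exp_pos _).le
  have he₁i : Integrable e₁ μ := integrable_of_abs_le he₁m he₁b
  have he₂i : Integrable e₂ μ := integrable_of_abs_le he₂m he₂b
  have hb₁i : Integrable b₁ μ := integrable_of_abs_le hb₁m hb₁b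
  have hb₂i : Integrable b₂ μ := integrable_of_abs_le hb₂m hb₂b
  -- `c` is `m`-measurable and a.e. bounded by `C_D`; `E` likewise bounded
  have hcm : StronglyMeasurable[m] c := stronglyMeasurable_condExp
  have hcm₀ : AEStronglyMeasurable c μ := (hcm.mono hm).aestronglyMeasurable
  have hgi₁ : Integrable (fun x => Real.exp (u * D x)) μ := he₁i
  have hac₁ : μ ≪ μ.tilted fun x => u * D x := absolutelyContinuous_tilted hgi₁
  have hcb : ∀ᵐ x ∂μ, ‖c x‖ ≤ CD := by
    have h := ae_bdd_abs_condExp_of_ae_bdd_abs (μ := μ.tilted fun x => u * D x) (m := m) (R := CD) (f := D)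
      (Eventually.of_forall fun x => hDb x)
    filter_upwards [hac₁.ae_le h] with x hx
    rw [Real.norm_eq_abs]; exact hx
  have hEm : StronglyMeasurable[m] E := Real.continuous_exp.comp_stronglyMeasurable (hcm.const_mul (u' - u))
  have hEm₀ : AEStronglyMeasurable E μ := (hEm.mono hm).aestronglyMeasurable
  have hEb : ∀ᵐ x ∂μ, ‖E x‖ ≤ Real.exp ((u' - u) * CD) := by
    filter_upwards [hcb] with x hx
    rw [Real.norm_eq_abs, hE]; dsimp only; rw [Real.abs_exp, Real.exp_le_exp]
    rw [Real.norm_eq_abs] at hx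
    exact mul_le_mul_of_nonneg_left ((le_abs_self _).trans hx) (sub_nonneg.2 huu')
  have hEcm : StronglyMeasurable[m] (E * c) := hEm.mul hcm
  have hEcb : ∀ᵐ x ∂μ, ‖(E * c) x‖ ≤ Real.exp ((u' - u) * CD) * CD := by
    filter_upwards [hcb, hEb] with x hx hx'
    rw [Pi.mul_apply, norm_mul]
    exact mul_le_mul hx' hx (norm_nonneg _) (Real.exp_pos _).le
  -- the integrable products
  have hce₂ : Integrable (c * e₂) μ := he₂i.bdd_mul hcm₀ hcb
  have hEb₁ : Integrable (E * b₁) μ := hb₁i.bdd_mul hEm₀ hEb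
  have hEce₁ : Integrable (E * c * e₁) μ := he₁i.bdd_mul (hEm₀.mul hcm₀) hEcb
  -- the pointwise inequality
  have hP : ∀ x, 0 ≤ (b₂ - c * e₂ - E * b₁ + E * c * e₁) x := fun x => by
    have hfac : 0 ≤ (D x - c x) * (Real.exp ((u' - u) * D x) - Real.exp ((u' - u) * c x)) := by
      rcases le_total (c x) (D x) with h | h
      · exact mul_nonneg (sub_nonneg.2 h)
          (sub_nonneg.2 (Real.exp_le_exp.2 (mul_le_mul_of_nonneg_left h (sub_nonneg.2 huu'))))
      · exact mul_nonneg_of_nonpos_of_nonpos (sub_nonpos.2 h)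
          (sub_nonpos.2 (Real.exp_le_exp.2 (mul_le_mul_of_nonneg_left h (sub_nonneg.2 huu'))))
    have hsplit : Real.exp (u' * D x) = Real.exp ((u' - u) * D x) * Real.exp (u * D x) := by
      rw [← Real.exp_add]; ring_nf
    have key : (b₂ - c * e₂ - E * b₁ + E * c * e₁) x =
        (D x - c x) * (Real.exp ((u' - u) * D x) - Real.exp ((u' - u) * c x)) * Real.exp (u * D x) := by
      simp only [hb₂, he₂, hb₁, he₁, hE, Pi.add_apply, Pi.sub_apply, Pi.mul_apply, smul_eq_mul, hsplit]
      ring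
    rw [key]
    exact mul_nonneg hfac (Real.exp_pos _).le
  -- pull it through `μ[· | m]`
  have hPi : Integrable (b₂ - c * e₂ - E * b₁ + E * c * e₁) μ := ((hb₂i.sub hce₂).sub hEb₁).add hEce₁
  have hcond : (0 : Ω → ℝ) ≤ᵐ[μ] μ[b₂ - c * e₂ - E * b₁ + E * c * e₁|m] := by
    have h := condExp_mono (m := m) (integrable_const (0 : ℝ)) hPi (Eventually.of_forall fun x => hP x)
    filter_upwards [h] with x hx
    rw [condExp_const hm] at hx
    exact hx
  have hlin : μ[b₂ - c * e₂ - E * b₁ + E * c * e₁|m] =ᵐ[μ]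
      μ[b₂|m] - c * μ[e₂|m] - E * μ[b₁|m] + E * c * μ[e₁|m] := by
    have h1 : μ[c * e₂|m] =ᵐ[μ] c * μ[e₂|m] := condExp_mul_of_stronglyMeasurable_left hcm hce₂ he₂i
    have h2 : μ[E * b₁|m] =ᵐ[μ] E * μ[b₁|m] := condExp_mul_of_stronglyMeasurable_left hEm hEb₁ hb₁i
    have h3 : μ[E * c * e₁|m] =ᵐ[μ] E * c * μ[e₁|m] := condExp_mul_of_stronglyMeasurable_left hEcm hEce₁ he₁i
    have h4 : μ[b₂ - c * e₂ - E * b₁ + E * c * e₁|m] =ᵐ[μ]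
        μ[b₂ - c * e₂ - E * b₁|m] + μ[E * c * e₁|m] := condExp_add ((hb₂i.sub hce₂).sub hEb₁) hEce₁ m
    have h5 : μ[b₂ - c * e₂ - E * b₁|m] =ᵐ[μ] μ[b₂ - c * e₂|m] - μ[E * b₁|m] := condExp_sub (hb₂i.sub hce₂) hEb₁ m
    have h6 : μ[b₂ - c * e₂|m] =ᵐ[μ] μ[b₂|m] - μ[c * e₂|m] := condExp_sub hb₂i hce₂ m
    filter_upwards [h1, h2, h3, h4, h5, h6] with x h1 h2 h3 h4 h5 h6
    rw [h4, Pi.add_apply, h5, Pi.sub_apply, h6, Pi.sub_apply, h1, h2, h3]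
    rfl
  -- conclude: the `u`-terms cancel by Bayes at `u`; divide by the normaliser at `u'`
  filter_upwards [hcond, hlin, hB₁, hA₁, hB₂, hA₂] with x h0 hl hb1 ha1 hb2 ha2
  have hA₁pos : 0 < (μ[e₁|m]) x := (Real.exp_pos _).trans_le ha1
  have hA₂pos : 0 < (μ[e₂|m]) x := (Real.exp_pos _).trans_le ha2
  -- Bayes at `u`: `μ[b₁|m] x = c x * μ[e₁|m] x`
  have hcu : (μ[b₁|m]) x = c x * (μ[e₁|m]) x := by
    have : c x = ((μ[e₁|m]) x)⁻¹ * (μ[b₁|m]) x := hb1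
    rw [this, mul_comm, ← mul_assoc, mul_inv_cancel₀ hA₁pos.ne', one_mul]
  rw [Pi.zero_apply, hl] at h0
  simp only [Pi.add_apply, Pi.sub_apply, Pi.mul_apply] at h0
  rw [hcu] at h0
  have h0' : c x * (μ[e₂|m]) x ≤ (μ[b₂|m]) x := by nlinarith [h0]
  -- Bayes at `u'`
  show c x ≤ ((μ.tilted fun x => u' * D x)[D|m]) x
  rw [hb2]
  rw [le_inv_mul_iff₀ hA₂pos]
  linarith [h0']

end Monotone

/-! ## §2 N1 TOY — matched endpoints, non-vanishing first-order Feynman–Hellmann term (the Λ-mismatch in miniature) -/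
section Toy

/-- Integration against the uniform law on `Bool × Bool`: the average of the four values. [folklore] -/
theorem integral_uniform_bool_sq (f : Bool × Bool → ℝ) :
    ∫ p, f p ∂((4 : ℝ≥0∞)⁻¹ • (Measure.count : Measure (Bool × Bool))) =
      4⁻¹ * (f (true, true) + f (true, false) + f (false, true) + f (false, false)) := by
  rw [integral_smul_measure, integral_count, ENNReal.toReal_inv]
  simp only [Fintype.sum_prod_type, Fintype.sum_bool, smul_eq_mul]
  norm_num
  ring

/-- The uniform law on `Bool × Bool` is a probability measure. [folklore] -/
theorem isProbabilityMeasure_uniform_bool_sq :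
    IsProbabilityMeasure ((4 : ℝ≥0∞)⁻¹ • (Measure.count : Measure (Bool × Bool))) := by
  constructor
  rw [Measure.smul_apply, smul_eq_mul, ← Finset.coe_univ, Measure.count_apply_finset]
  simp only [Finset.card_univ, Fintype.card_prod, Fintype.card_bool]
  norm_num
  exact ENNReal.inv_mul_cancel (by norm_num) (by norm_num)

/-- **N1 TOY** (LENS control sketch §5, credited) [folklore; explicit 4-point computation]: unit field `x = p.1`, fluctuation `z = p.2`, uniform law; observable
`F = ±1` (fibre-blind); defect `D = a·F + c·𝟙{x ∧ z}` with `a = −½·log((1 + e^c)∕2)` chosen so that the ENDPOINTS MATCH (`E_{μ.tilted D} F = E_μ F = 0`).  Yet the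
first-order Feynman–Hellmann term does not vanish: `Cov_μ(F, D) = −½·log cosh(c∕2)` (`≠ 0` for `c ≠ 0`) — because the fibre log-partition function
`u ↦ log E[e^{uD} | x]` is STRICTLY CONVEX and non-affine in `u`, matching the endpoints leaves `E_{μ.tilted (uD)} F ≠ 0` in the interior. -/
theorem toy_matchedEndpoints_cov_ne_zero (c : ℝ) :
    let μ : Measure (Bool × Bool) := (4 : ℝ≥0∞)⁻¹ • Measure.count
    let F : Bool × Bool → ℝ := fun p => if p.1 then 1 else -1
    let D : Bool × Bool → ℝ := fun p => (-(Real.log ((1 + Real.exp c) / 2)) / 2) * F p + (if p.1 ∧ p.2 then c else 0)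
    tiltedMean F (μ.tilted D) 0 = tiltedMean F μ 0 ∧ cov[F, D; μ] = -(Real.log (Real.cosh (c / 2))) / 2 := by
  intro μ F D
  -- letters: q = (1 + e^c)/2, a = -½ log q, and the key identity e^{a}·q = e^{-a}
  set q : ℝ := (1 + Real.exp c) / 2 with hq
  have hqpos : 0 < q := by rw [hq]; positivity
  set a : ℝ := -(Real.log q) / 2 with ha
  have hkey : Real.exp a * q = Real.exp (-a) := by
    have h2 : Real.exp a * Real.exp a * q = 1 := by
      rw [← Real.exp_add, show a + a = -Real.log q by rw [ha]; ring, Real.exp_neg, Real.exp_log hqpos,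
        inv_mul_cancel₀ hqpos.ne']
    have hea : Real.exp a ≠ 0 := (Real.exp_pos a).ne'
    rw [Real.exp_neg]
    field_simp
    linarith [h2]
  -- the measure and the integrals
  haveI hμ : IsProbabilityMeasure μ := isProbabilityMeasure_uniform_bool_sq
  have hint : ∀ f : Bool × Bool → ℝ, ∫ p, f p ∂μ = 4⁻¹ * (f (true, true) + f (true, false) + f (false, true) + f (false, false)) :=
    integral_uniform_bool_sq
  have hFm : Measurable F := measurable_of_countable F
  have hDm : Measurable D := measurable_of_countable D
  have hDi : Integrable (fun p => Real.exp (D p)) μ := Integrable.of_finite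
  haveI : IsProbabilityMeasure (μ.tilted D) := isProbabilityMeasure_tilted hDi
  -- values of the letters
  have hF1 : F (true, true) = 1 := rfl
  have hF2 : F (true, false) = 1 := rfl
  have hF3 : F (false, true) = -1 := rfl
  have hF4 : F (false, false) = -1 := rfl
  have hD1 : D (true, true) = a + c := by show (-(Real.log q) / 2) * F (true, true) + _ = _; simp [hF1, ha]
  have hD2 : D (true, false) = a := by show (-(Real.log q) / 2) * F (true, false) + _ = _; simp [hF2, ha]
  have hD3 : D (false, true) = -a := by show (-(Real.log q) / 2) * F (false, true) + _ = _; simp [hF3, ha]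
  have hD4 : D (false, false) = -a := by show (-(Real.log q) / 2) * F (false, false) + _ = _; simp [hF4, ha]
  -- zero-tilt means are plain means
  have h0 : ∀ (ν : Measure (Bool × Bool)) [IsProbabilityMeasure ν], tiltedMean F ν 0 = ∫ p, F p ∂ν := fun ν _ => by
    simp only [tiltedMean, zero_mul]
    rw [tilted_const]
  constructor
  · -- Σ e^{D}F = e^{a+c} + e^{a} − 2e^{−a} = 0, so both means vanish
    have hsum : Real.exp (a + c) + Real.exp a - Real.exp (-a) - Real.exp (-a) = 0 := by
      rw [Real.exp_add, ← hkey, hq]; ring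
    have hR : ∫ p, F p ∂μ = 0 := by rw [hint]; simp only [hF1, hF2, hF3, hF4]; norm_num
    have hL : ∫ p, F p ∂(μ.tilted D) = 0 := by
      rw [integral_tilted, hint]
      set Z : ℝ := ∫ p, Real.exp (D p) ∂μ
      simp only [smul_eq_mul, hF1, hF2, hF3, hF4, hD1, hD2, hD3, hD4]
      have : (4 : ℝ)⁻¹ * (Real.exp (a + c) / Z * 1 + Real.exp a / Z * 1 + Real.exp (-a) / Z * -1 + Real.exp (-a) / Z * -1) =
          4⁻¹ * Z⁻¹ * (Real.exp (a + c) + Real.exp a - Real.exp (-a) - Real.exp (-a)) := by ring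
      rw [this, hsum, mul_zero]
    rw [h0, h0, hL, hR]
  · have hFb : ∀ᵐ p ∂μ, ‖F p‖ ≤ 1 := ae_of_all _ fun p => by
      rw [Real.norm_eq_abs]; show |(if p.1 then (1 : ℝ) else -1)| ≤ 1; split_ifs <;> simp
    have hDb : ∀ᵐ p ∂μ, ‖D p‖ ≤ |a| + |c| + |a| := ae_of_all _ fun p => by
      rw [Real.norm_eq_abs]
      rcases p with ⟨x, z⟩
      cases x <;> cases z <;> simp only [hD1, hD2, hD3, hD4] <;>
        [exact (abs_neg a).le.trans (by linarith [abs_nonneg c, abs_nonneg a]);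
         exact (abs_neg a).le.trans (by linarith [abs_nonneg c, abs_nonneg a]);
         linarith [abs_nonneg c, abs_nonneg a];
         exact (abs_add_le a c).trans (by linarith [abs_nonneg a])]
    rw [covariance_eq_sub (MemLp.of_bound hFm.aestronglyMeasurable 1 hFb) (MemLp.of_bound hDm.aestronglyMeasurable _ hDb)]
    simp only [Pi.mul_apply]
    rw [hint, hint, hint]
    simp only [hF1, hF2, hF3, hF4, hD1, hD2, hD3, hD4]
    -- 4⁻¹(4a + c) = a + c/4 = −½ log cosh(c/2)
    have hcosh : Real.log (Real.cosh (c / 2)) = Real.log q - c / 2 := by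
      rw [Real.cosh_eq, hq]
      have : (Real.exp (c / 2) + Real.exp (-(c / 2))) / 2 = Real.exp (-(c / 2)) * ((1 + Real.exp c) / 2) := by
        have e1 : Real.exp c = Real.exp (c / 2) * Real.exp (c / 2) := by rw [← Real.exp_add]; ring_nf
        have e2 : Real.exp (-(c / 2)) * Real.exp (c / 2) = 1 := by rw [← Real.exp_add]; simp
        rw [e1]; linear_combination (-(Real.exp (c / 2)) / 2) * e2
      rw [this, Real.log_mul (Real.exp_pos _).ne' hqpos.ne', Real.log_exp]
      ring
    rw [hcosh, ha]
    ring

/-! ### v1.1 (APPEND-ONLY; dag-n14-c g8) — referee ref-I READ-194 NIT-N1 discharged: the toy's covariance is NONZERO -/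

/-- `log cosh x > 0` for `x ≠ 0` (`Real.one_lt_cosh`). [folklore] -/
theorem log_cosh_pos {x : ℝ} (hx : x ≠ 0) : 0 < Real.log (Real.cosh x) :=
  Real.log_pos (Real.one_lt_cosh.2 hx)

/-- **N1 TOY, THE `≠ 0` SENTENCE THE NAME PROMISED** (ref-I READ-194 NIT-N1: «name says `cov_ne_zero`, statement is the equality; `≠ 0` for
`c ≠ 0` is one line, not asserted» — asserted here) [decided toy]: for `c ≠ 0` the matched-endpoints toy has `cov[F, D; μ] < 0`, in
particular `≠ 0` — matched endpoints do NOT force the Feynman–Hellmann covariance along the straight chord to vanish. [folklore] -/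
theorem toy_matchedEndpoints_cov_neg {c : ℝ} (hc : c ≠ 0) :
    let μ : Measure (Bool × Bool) := (4 : ℝ≥0∞)⁻¹ • Measure.count
    let F : Bool × Bool → ℝ := fun p => if p.1 then 1 else -1
    let D : Bool × Bool → ℝ := fun p => (-(Real.log ((1 + Real.exp c) / 2)) / 2) * F p + (if p.1 ∧ p.2 then c else 0)
    tiltedMean F (μ.tilted D) 0 = tiltedMean F μ 0 ∧ cov[F, D; μ] < 0 ∧ cov[F, D; μ] ≠ 0 := by
  intro μ F D
  have h := toy_matchedEndpoints_cov_ne_zero c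
  have hneg : -(Real.log (Real.cosh (c / 2))) / 2 < 0 := by
    have := log_cosh_pos (x := c / 2) (by intro h0; exact hc (by linarith))
    linarith
  exact ⟨h.1, lt_of_eq_of_lt h.2 hneg, (lt_of_eq_of_lt h.2 hneg).ne⟩

end Toy

end YMDAG.N14.LawChannelStraightChord

end
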